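import Summits.CriticalPhenomena.SAWScalingLimit.Theorems.SAWRenewalTightnessTubeLowerBoundBPDOfSpanHyperscalingBreaks

/-!
# Sub-goal `breakPointDensity_of_tailHalving` of the line `profile-potential`
(crux `TubeLowerBound`, stmt-CriticalPhenomena-4730), part I: the renewal families

Word model of `SAWWords.lean` / `SAWWordBridges.lean` at the critical fugacity `x_c`
(`criticalFugacity`); the "mass" of a finite family of words is `Σ x_c^{|w|}`.

**Renewal families** (`renewalPairs`, the registered sub-goal `bpd_renewalPairs`).  Fix a finite
family `S₀` of irreducible bridges of mass `≥ a` (by Kesten's identity `Σ_irr x_c^{|ι|} = 1`,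
`KestenIdentity.exists_partialSum_gt`, such families exist for every `a < 1`).  For every level `n`
there is a finite family `P` of PAIRS `(b, ι)` — `b` a self-avoiding bridge word of span `≤ n`
("the word up to its last break point"), `ι` an irreducible bridge with `span b + span ι ≥ n + 1`
("the last irreducible factor, crossing the level `n + 1/2`") — of mass
`Σ x_c^{|b| + |ι|} ≥ a^{n+1}`.  Induction on `n`: the pairs with `span > n + 1` are kept, and each
pair with `span b + span ι = n + 1` is replaced by the pairs `(b ++ ι, ι')`, `ι' ∈ S₀`; the new pairs
are distinct from each other (unique decoding of the LAST irreducible factor,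
`eq_of_append_eq_last`) and from the kept ones (their prefix has span exactly `n + 1`), so the mass
is `mass(kept) + mass(replaced) · mass(S₀) ≥ a · mass ≥ a^{n+2}` (`mass(S₀) ≤ 1`,
`KestenIdentity.partialSum_le_one`).  Part II (`…BPDOfTailHalving.lean`) truncates the last
factors by the tail-halving hypothesis and reglues.

References: H. Kesten, *On the number of self-avoiding walks*, J. Math. Phys. 4 (1963), §4
(break points, unique factorisation of bridges into irreducible bridges); N. Madras, G. Slade,
*The Self-Avoiding Walk* (1993), §4.2, (4.2.1)–(4.2.4).
-/

noncomputable section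

namespace Summit.CriticalPhenomena.SAWScalingLimit.Theorems.TubeLowerBound.SubcriticalRenewalFloor

open scoped BigOperators Classical
open Literature.Probability.LatticeModels
open Literature.Probability.RandomPlanarGeometry Literature.Probability.RandomPlanarGeometry.SAW

namespace BPDOfTailHalving

open Finset

/-! ### Unique decoding of the last irreducible factor -/

/-- **Unique decoding, last factor.** If `b ++ g = b' ++ g'` with `b, b'` bridges and `g, g'`
irreducible bridges, then `b = b'` and `g = g'`: otherwise (say `|b| < |b'|`) the junction `|b'|`
is a break point of `b' ++ g' = b ++ g` beyond `|b|`, i.e. a break point of `g`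
(`BPD.isBreak_of_append_right`). [cite: Kesten1963SAW, §4] -/
theorem eq_of_append_eq_last {b b' g g' : List Step} (hb : IsBridgeW b) (hb' : IsBridgeW b')
    (hg : IsIrrBridge g) (hg' : IsIrrBridge g') (h : b ++ g = b' ++ g') : b = b' ∧ g = g' := by
  -- adapted from `SAW.eq_of_append_eq` (first factors) of `SAWWordBridges.lean`
  suffices hbb : b = b' by
    subst hbb
    exact ⟨rfl, List.append_cancel_left h⟩
  wlog hle : b.length ≤ b'.length generalizing b b' g g'
  · exact (this hb' hb hg' hg h.symm (by omega)).symm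
  rcases hle.eq_or_lt with heq | hlt
  · exact List.append_inj_left h heq
  · exfalso
    set u := b'.drop b.length with hu_def
    have e1 : b'.take b.length = b := by
      have := congrArg (List.take b.length) h
      rwa [List.take_append_of_le_length le_rfl, List.take_length,
        List.take_append_of_le_length hle, eq_comm] at this
    have e2 : b' = b ++ u := by
      conv_lhs => rw [← List.take_append_drop b.length b']
      rw [e1]
    have hu : 0 < u.length := by
      rw [hu_def, List.length_drop]; omega
    have hne' : b' ≠ [] := by
      rw [ne_eq, ← List.length_eq_zero_iff]; omega
    have hbr := BPD.isBreak_append_length hb' hne' hg'.ne_nil hg'.bridge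
    rw [← h, e2, List.length_append] at hbr
    exact hg.irr _ (BPD.isBreak_of_append_right hu hbr)

/-! ### The renewal families of pairs -/

/-- **Renewal families.** For a finite family `S₀` of irreducible bridges of mass `≥ a ≥ 0` and
every level `n`, there is a finite family of pairs `(b, ι)` — `b` a self-avoiding bridge word of
span `≤ n`, `ι` an irreducible bridge, `span b + span ι ≥ n + 1` — of mass
`Σ x_c^{|b| + |ι|} ≥ a^{n+1}` (Kesten's span renewal run up to level `n`, keeping only finitely many
words at each step). [cite: Kesten1963SAW, §4] -/
theorem renewalPairs {a : ℝ} {S₀ : Finset (List Step)} (ha : 0 ≤ a)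
    (hS₀ : ∀ s ∈ S₀, IsIrrBridge s) (haS : a ≤ ∑ s ∈ S₀, criticalFugacity ^ s.length) (n : ℕ) :
    ∃ P : Finset (List Step × List Step),
      (∀ p ∈ P, IsSAW p.1 ∧ IsBridgeW p.1 ∧ xEnd p.1 ≤ (n : ℤ) ∧ IsIrrBridge p.2 ∧
        (n : ℤ) + 1 ≤ xEnd p.1 + xEnd p.2) ∧
      a ^ (n + 1) ≤ ∑ p ∈ P, criticalFugacity ^ (p.1.length + p.2.length) := by
  have hxc : 0 < criticalFugacity := StripMass.criticalFugacity_pos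
  have ha1 : a ≤ 1 := haS.trans (KestenIdentity.partialSum_le_one S₀ hS₀)
  have hnil : xEnd ([] : List Step) = 0 := by simp [xEnd]
  induction n with
  | zero =>
    refine ⟨S₀.image (fun ι => (([] : List Step), ι)), ?_, ?_⟩
    · intro p hp
      obtain ⟨ι, hι, rfl⟩ := Finset.mem_image.1 hp
      have hirr := hS₀ ι hι
      have h1 := StripMass.one_le_xEnd_of_ne_nil hirr.bridge hirr.ne_nil
      refine ⟨isSAW_nil, isBridgeW_nil, ?_, hirr, ?_⟩
      · show xEnd ([] : List Step) ≤ ((0 : ℕ) : ℤ)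
        rw [hnil, Nat.cast_zero]
      · show ((0 : ℕ) : ℤ) + 1 ≤ xEnd ([] : List Step) + xEnd ι
        rw [hnil, Nat.cast_zero]
        omega
    · rw [Finset.sum_image]
      · simpa only [List.length_nil, zero_add, pow_one] using haS
      · intro ι _ ι' _ h
        exact (Prod.ext_iff.1 h).2
  | succ n ih =>
    obtain ⟨P, hP, hmass⟩ := ih
    -- kept pairs `K` (span `> n + 1`), pairs to extend `E` (span `= n + 1`), glued pairs `G`
    set K := P.filter (fun p => (n : ℤ) + 1 < xEnd p.1 + xEnd p.2) with hK
    set E := P.filter (fun p => ¬ ((n : ℤ) + 1 < xEnd p.1 + xEnd p.2)) with hE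
    set G := (E ×ˢ S₀).image
      (fun q : (List Step × List Step) × List Step => (q.1.1 ++ q.1.2, q.2)) with hG
    have hEspan : ∀ p ∈ E, xEnd p.1 + xEnd p.2 = (n : ℤ) + 1 := fun p hp => by
      obtain ⟨hpP, hnot⟩ := Finset.mem_filter.1 hp
      have := (hP p hpP).2.2.2.2
      omega
    refine ⟨K ∪ G, ?_, ?_⟩
    · -- the invariant at level `n + 1`
      intro p hp
      rcases Finset.mem_union.1 hp with hpK | hpG
      · obtain ⟨hpP, hlt⟩ := Finset.mem_filter.1 hpK
        obtain ⟨hs, hb, hx, hirr, -⟩ := hP p hpP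
        refine ⟨hs, hb, ?_, hirr, ?_⟩
        · push_cast; omega
        · push_cast; omega
      · obtain ⟨q, hq, rfl⟩ := Finset.mem_image.1 hpG
        obtain ⟨hqE, hqS⟩ := Finset.mem_product.1 hq
        obtain ⟨hs, hb, -, hirr, -⟩ := hP q.1 (Finset.mem_filter.1 hqE).1
        have hspan := hEspan q.1 hqE
        have hirr' := hS₀ q.2 hqS
        have h1 := StripMass.one_le_xEnd_of_ne_nil hirr'.bridge hirr'.ne_nil
        refine ⟨hs.append_of_bridge hirr.saw hb hirr.bridge, hb.append hirr.bridge, ?_, hirr', ?_⟩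
        · show xEnd (q.1.1 ++ q.1.2) ≤ ((n + 1 : ℕ) : ℤ)
          rw [xEnd_append]; push_cast; omega
        · show ((n + 1 : ℕ) : ℤ) + 1 ≤ xEnd (q.1.1 ++ q.1.2) + xEnd q.2
          rw [xEnd_append]; push_cast; omega
    · -- the mass
      have hdisj : Disjoint K G := by
        rw [Finset.disjoint_left]
        intro p hpK hpG
        obtain ⟨q, hq, rfl⟩ := Finset.mem_image.1 hpG
        obtain ⟨hqE, -⟩ := Finset.mem_product.1 hq
        have hspan := hEspan q.1 hqE
        obtain ⟨-, -, hx, -, -⟩ := hP _ (Finset.mem_filter.1 hpK).1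
        change xEnd (q.1.1 ++ q.1.2) ≤ (n : ℤ) at hx
        rw [xEnd_append] at hx
        omega
      have hinj : Set.InjOn (fun q : (List Step × List Step) × List Step => (q.1.1 ++ q.1.2, q.2))
          ↑(E ×ˢ S₀) := by
        rintro ⟨⟨b, ι⟩, ι'⟩ hq ⟨⟨b', ι''⟩, ι'''⟩ hq' heq
        simp only [Prod.mk.injEq] at heq
        obtain ⟨h1, rfl⟩ := heq
        rw [Finset.mem_coe, Finset.mem_product] at hq hq'
        obtain ⟨-, hb, -, hirr, -⟩ := hP _ (Finset.mem_filter.1 hq.1).1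
        obtain ⟨-, hb', -, hirr', -⟩ := hP _ (Finset.mem_filter.1 hq'.1).1
        obtain ⟨rfl, rfl⟩ := eq_of_append_eq_last hb hb' hirr hirr' h1
        rfl
      have hGsum : ∑ p ∈ G, criticalFugacity ^ (p.1.length + p.2.length) =
          (∑ p ∈ E, criticalFugacity ^ (p.1.length + p.2.length)) *
            ∑ s ∈ S₀, criticalFugacity ^ s.length := by
        rw [hG, Finset.sum_image hinj, Finset.sum_product, Finset.sum_mul]
        refine Finset.sum_congr rfl fun p _ => ?_
        rw [Finset.mul_sum]
        refine Finset.sum_congr rfl fun s _ => ?_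
        rw [List.length_append, pow_add]
      have hPsum : ∑ p ∈ P, criticalFugacity ^ (p.1.length + p.2.length) =
          ∑ p ∈ K, criticalFugacity ^ (p.1.length + p.2.length) +
            ∑ p ∈ E, criticalFugacity ^ (p.1.length + p.2.length) :=
        (Finset.sum_filter_add_sum_filter_not P _ _).symm
      have hKnn : 0 ≤ ∑ p ∈ K, criticalFugacity ^ (p.1.length + p.2.length) :=
        Finset.sum_nonneg fun _ _ => pow_nonneg hxc.le _
      have hEnn : 0 ≤ ∑ p ∈ E, criticalFugacity ^ (p.1.length + p.2.length) :=
        Finset.sum_nonneg fun _ _ => pow_nonneg hxc.le _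
      rw [Finset.sum_union hdisj, hGsum]
      rw [hPsum] at hmass
      calc a ^ (n + 1 + 1) = a * a ^ (n + 1) := by ring
        _ ≤ a * (∑ p ∈ K, criticalFugacity ^ (p.1.length + p.2.length) +
              ∑ p ∈ E, criticalFugacity ^ (p.1.length + p.2.length)) :=
            mul_le_mul_of_nonneg_left hmass ha
        _ = a * ∑ p ∈ K, criticalFugacity ^ (p.1.length + p.2.length) +
              (∑ p ∈ E, criticalFugacity ^ (p.1.length + p.2.length)) * a := by ring
        _ ≤ ∑ p ∈ K, criticalFugacity ^ (p.1.length + p.2.length) +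
              (∑ p ∈ E, criticalFugacity ^ (p.1.length + p.2.length)) *
                ∑ s ∈ S₀, criticalFugacity ^ s.length :=
            add_le_add (mul_le_of_le_one_left hKnn ha1) (mul_le_mul_of_nonneg_left haS hEnn)

end BPDOfTailHalving

/-- **Renewal families** (registered sub-goal `bpd_renewalPairs` of the crux item; part I of the
census link `breakPointDensity_of_tailHalving`): for a finite family `S₀` of irreducible bridges of
critical mass `≥ a ≥ 0` and every level `n`, some finite family of pairs `(b, ι)` — `b` a
self-avoiding bridge word of span `≤ n`, `ι` an irreducible bridge with `span b + span ι ≥ n + 1` —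
has critical mass `Σ x_c^{|b| + |ι|} ≥ a^{n+1}`. [cite: Kesten1963SAW, §4] -/
theorem bpd_renewalPairs :
    ∀ (a : ℝ) (S₀ : Finset (List Step)), 0 ≤ a → (∀ s ∈ S₀, IsIrrBridge s) → a ≤ ∑ s ∈ S₀, criticalFugacity ^ s.length → ∀ n : ℕ, ∃ P : Finset (List Step × List Step), (∀ p ∈ P, IsSAW p.1 ∧ IsBridgeW p.1 ∧ xEnd p.1 ≤ (n : ℤ) ∧ IsIrrBridge p.2 ∧ (n : ℤ) + 1 ≤ xEnd p.1 + xEnd p.2) ∧ a ^ (n + 1) ≤ ∑ p ∈ P, criticalFugacity ^ (p.1.length + p.2.length) :=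
  fun _ _ ha hS₀ haS n => BPDOfTailHalving.renewalPairs ha hS₀ haS n

end Summit.CriticalPhenomena.SAWScalingLimit.Theorems.TubeLowerBound.SubcriticalRenewalFloor

end
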